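import Summits.ResolutionOfSingularities.ResolutionOfSingularities.Theorems.HomologicalConductorNoZenoRFirstKindCycle
import Summits.ResolutionOfSingularities.ResolutionOfSingularities.Theorems.HomologicalConductorNoZenoRQuadraticTransformDominated
import Summits.ResolutionOfSingularities.ResolutionOfSingularities.Theorems.HomologicalConductorNoZenoBaseIdealPNonempty
import Literature.AlgebraicGeometry.Resolution.DivisorialPart
import Literature.AlgebraicGeometry.Resolution.ExceptionalFibreConnected
import Literature.AlgebraicGeometry.Resolution.Principalization
import HarnessLib

/-!
# Crux `NoZenoR` (stmt-ResolutionOfSingularities-19943) — over a NON-REGULAR rational surface singularity, a first-kind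
# exceptional curve `E` which is not the whole closed fibre has `(Z·E) = 0` for the cycle `Z` of `𝔪𝒪_X`
# (it is numerically contracted by `X → Bl_𝔪 Spec S`); the base ideal as a product of exceptional primes

Route `ResolutionOfSingularities/HomologicalConductor` (cell decomp-res, hand leafhand-res-homologicalconduct-24 g0).
OURS: AI-written proof over tree theorems, weaker than expert review; nothing here is a statement of the manuscript
under review (Hironaka 2017).  SUPPORT level, counted 0.  Def-free, fact-free.

Sequel of `…NoZenoRFirstKindCycle` (numerical core: a first-kind curve `E ⊆ Z`, `h⁰(𝒪_Z) ≤ 1`, `(Z·E) < 0` ⇒ `Z = E`).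
Here `Z` is the cycle of the base ideal `𝔪𝒪_X` of a desingularization `π : X → Spec S` of a two-dimensional Noetherian
local normal domain `S` with a rational singularity, `S` NOT regular (`𝔪𝒪_X` invertible — Lipman Prop. (3.1), tree
`QuadraticTransform.isEffectiveCartier_baseIdeal_maximalIdeal`; `h⁰(𝒪_X/𝔪𝒪_X) ≤ 1` — tree
`QuadraticTransform.h0_baseIdeal_maximalIdeal_le_one`; `(Z·E_η) ≤ 0` — tree `ExcCount.excCurveDegree_baseIdealDivisor_nonpos`):

* `exists_multiset_prod_map_eq_finset_prod_pow` — bookkeeping: a finite product of powers is a multiset product;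
* `exists_eq_prod_primeDivisorIdeal_of_isEffectiveCartier` — on a desingularization of a non-regular `Spec S`, an
  invertible ideal sheaf cosupported in the closed fibre is a product `∏_{ζ∈t} 𝓘_ζ` of prime ideals of integral
  exceptional curves (divisorial part on the regular surface, `Resolution/DivisorialPart`);
* `exists_baseIdeal_maximalIdeal_eq_prod` — in particular `𝔪𝒪_X = ∏_{ζ∈t} 𝓘_ζ`;
* **`baseIdeal_eq_primeDivisorIdeal_of_firstKind_of_excCurveDegree_neg`** — `E_η` of the first kind with `(Z·E_η) < 0`
  ⇒ `𝔪𝒪_X = 𝓘_η` (the closed fibre is the reduced curve `E_η`);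
* **`excCurveDegree_baseIdeal_eq_zero_or_eq_of_firstKind`** — the dichotomy `(Z·E_η) = 0 ∨ 𝔪𝒪_X = 𝓘_η`.

Road (memo HOME/leafhand-res-homologicalconduct-24-g0/MEMO-19943-hand24g0-M0-ROAD.md): `𝔪𝒪_X = 𝓘_η` with `E_η` of the
first kind forces `S` regular (`ℓ(S/𝔪²) ≤ h⁰(𝒪_X/𝔪²𝒪_X) = 3`), so over a non-regular rational `S` EVERY first-kind
curve has `(Z·E) = 0`; with the localisation of the minimal desingularization over the quadratic transform this is the
induction step of «the minimal desingularization has no first-kind curve» (Lipman (27.3) «⇒» without (27.1)).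
No crux or summit statement is proved here.
-/

noncomputable section

-- single-problem summit: the doubled namespace component `ResolutionOfSingularities` is forced
set_option linter.dupNamespace false

open CategoryTheory CategoryTheory.Limits AlgebraicGeometry TopologicalSpace IsLocalRing
open Literature.AlgebraicGeometry.Resolution Literature.AlgebraicGeometry.Motives
open Scheme.IdealSheafData

namespace Summit.ResolutionOfSingularities.ResolutionOfSingularities.Theorems.NoZeno.FirstKind

/-! ## §1 Bookkeeping: finite products of powers are multiset products -/

/-- A finite product of powers `∏_{ζ ∈ F} f(ζ)^{n(ζ)}` in a commutative monoid is the product of `f` over a multiset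
supported in `F` (each `ζ` repeated `n(ζ)` times). [folklore] -/
theorem exists_multiset_prod_map_eq_finset_prod_pow {α M : Type*} [CommMonoid M] (f : α → M) (n : α → ℕ)
    (F : Finset α) :
    ∃ t : Multiset α, (∀ ζ ∈ t, ζ ∈ F) ∧ (t.map f).prod = ∏ ζ ∈ F, f ζ ^ n ζ := by
  classical
  induction F using Finset.induction_on with
  | empty => exact ⟨0, fun _ h => absurd h (Multiset.notMem_zero _), by simp⟩
  | insert a s ha ih =>
    obtain ⟨t, ht, hprod⟩ := ih
    refine ⟨Multiset.replicate (n a) a + t, fun ζ hζ => ?_, ?_⟩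
    · rcases Multiset.mem_add.mp hζ with h | h
      · rw [Multiset.eq_of_mem_replicate h]
        exact Finset.mem_insert_self a s
      · exact Finset.mem_insert_of_mem (ht ζ h)
    · rw [Multiset.map_add, Multiset.prod_add, Multiset.map_replicate, Multiset.prod_replicate, hprod,
        Finset.prod_insert ha]

/-! ## §2 Invertible ideal sheaves in the closed fibre are products of exceptional primes -/

section Product

variable {S : Type} [CommRing S] [IsNoetherianRing S] [IsLocalRing S] [IsDomain S] [IsIntegrallyClosed S]
  {X : Scheme.{0}} (π : X ⟶ Spec (.of S))

/-- **An invertible ideal sheaf cosupported in the closed fibre is a product of prime ideals of integral exceptional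
curves.**  On a desingularization `π : X → Spec S` of a two-dimensional Noetherian local normal domain which is not
regular, an effective Cartier ideal sheaf `I ≠ 0` with `V(I) ⊆ π⁻¹(𝔪)` equals `∏_{ζ∈t} 𝓘_ζ` for a multiset `t` of
points of `excCurvePoints π`: `I` coincides with its divisorial part `∏ 𝓘_ζ^{ord_ζ I}` (`Resolution/DivisorialPart`,
the codimension-two part of a locally principal ideal is trivial), and the codimension-one points of `V(I)` are
generic points of integral exceptional curves. [cite: Lipman1969, Section 14 (p. 224); CossartPiltant2008, proof of Prop. 4.2] -/
theorem exists_eq_prod_primeDivisorIdeal_of_isEffectiveCartier (hdim : ringKrullDim S = 2)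
    (hsing : ¬ IsRegularLocalRing S) (hπ : IsResolution π) {I : X.IdealSheafData} (hI : IsEffectiveCartier I)
    (hI0 : I ≠ ⊥) (hsupp : ∀ x ∈ (I.support : Set X), π.base x = closedPoint S) :
    ∃ t : Multiset X, (∀ ζ ∈ t, ζ ∈ excCurvePoints π) ∧ I = (t.map primeDivisorIdeal).prod := by
  classical
  haveI : IsProper π := hπ.isProper
  haveI : IsIntegral X := hπ.isIntegral_source
  haveI : IsLocallyNoetherian X := LocallyOfFiniteType.isLocallyNoetherian π
  haveI : CompactSpace X := QuasiCompact.compactSpace_of_compactSpace π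
  haveI : IsNoetherian X := {}
  have hX : Scheme.IsRegular X := hπ.isRegular
  -- the codimension-two part of the locally principal `I` is trivial: `I` is its divisorial part
  have hK : codimTwoPart I = ⊤ := (isLocallyPrincipal_iff_codimTwoPart_eq_top hX hI0).mp hI.isLocallyPrincipal
  have hIH : I = divisorialPart I := by
    conv_lhs => rw [← divisorialPart_mul_codimTwoPart hX hI0, hK, ← one_eq_top, mul_one]
  have hfin := finite_divisorialPoints (X := X) hI0
  rw [divisorialPart_eq hfin] at hIH
  obtain ⟨t, htF, ht⟩ := exists_multiset_prod_map_eq_finset_prod_pow (primeDivisorIdeal (X := X))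
    (fun ζ => (idealOrder I ζ).toNat) hfin.toFinset
  refine ⟨t, fun ζ hζ => ?_, hIH.trans ht.symm⟩
  have hζd : ζ ∈ divisorialPoints I := (Set.Finite.mem_toFinset _).mp (htF ζ hζ)
  exact hπ.mem_excCurvePoints_of_coheight_eq_one hdim hsing (hsupp ζ hζd.1) hζd.2

/-- **`𝔪𝒪_X = ∏_{ζ∈t} 𝓘_ζ`**: on a desingularization of a NON-regular rational surface singularity the base ideal of
`𝔪` (invertible by Lipman Prop. (3.1), tree `QuadraticTransform.isEffectiveCartier_baseIdeal_maximalIdeal`) is a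
product of prime ideals of integral exceptional curves — the cycle `Z` with `𝔪𝒪_X = 𝒪_X(−Z)`.
[cite: Lipman1969, Proposition (3.1) (p. 203); Section 14 (p. 224)] -/
theorem exists_baseIdeal_maximalIdeal_eq_prod (hdim : ringKrullDim S = 2) (hrat : HasRationalSingularity S)
    (hsing : ¬ IsRegularLocalRing S) (hπ : IsResolution π) :
    ∃ t : Multiset X, (∀ ζ ∈ t, ζ ∈ excCurvePoints π) ∧
      Scheme.IdealSheafData.ofIdealTop ((maximalIdeal S).map (Literature.AlgebraicGeometry.Morphisms.algebraMapΓ π)) = (t.map primeDivisorIdeal).prod := by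
  haveI : IsIntegral X := hπ.isIntegral_source
  refine exists_eq_prod_primeDivisorIdeal_of_isEffectiveCartier π hdim hsing hπ
    (QuadraticTransform.isEffectiveCartier_baseIdeal_maximalIdeal π hdim hrat hsing hπ)
    (QuadraticTransform.baseIdeal_maximalIdeal_ne_bot π hdim hπ) fun x hx => ?_
  have hsupp : ((Scheme.IdealSheafData.ofIdealTop ((maximalIdeal S).map (Literature.AlgebraicGeometry.Morphisms.algebraMapΓ π))).support : Set X) =
      π.base ⁻¹' {closedPoint S} := ExcCount.support_baseIdeal_eq π (c := 1) (by rw [pow_one]) le_rfl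
  rw [hsupp] at hx
  exact hx

end Product

/-! ## §3 First-kind curves against the cycle of `𝔪𝒪_X` -/

section BaseCycle

variable {S : Type} [CommRing S] [IsNoetherianRing S] [IsLocalRing S] [IsDomain S] [IsIntegrallyClosed S]
  {X : Scheme.{0}} [IsIntegral X] [IsLocallyNoetherian X] (π : X ⟶ Spec (.of S))

/-- **A first-kind curve with `(Z·E) < 0` IS the closed fibre: `𝔪𝒪_X = 𝓘_η`.**  `S` a two-dimensional Noetherian
local normal domain with a rational singularity, not regular; `π : X → Spec S` a desingularization; `Z` the cycle of
the invertible ideal `𝔪𝒪_X` (`h⁰(𝒪_Z) ≤ 1`); `E_η` an integral exceptional curve of the first kind with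
`(Z·E_η) < 0`.  Then `𝔪𝒪_X = 𝓘_η` (numerical core `eq_singleton_of_firstKind_of_h0_le_one_of_excCurveDegree_neg`
applied to `𝔪𝒪_X = ∏_{ζ∈t} 𝓘_ζ`). [cite: Lipman1969, Proposition (3.1) (p. 203); Proposition (13.1) b), c), d) (p. 223)] -/
theorem baseIdeal_eq_primeDivisorIdeal_of_firstKind_of_excCurveDegree_neg (hdim : ringKrullDim S = 2)
    (hrat : HasRationalSingularity S) (hsing : ¬ IsRegularLocalRing S) (hπ : IsResolution π)
    {η : X} (hη : η ∈ excCurvePoints π)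
    (hfk : h0 π (primeDivisorIdeal η ^ 2) = 3 * h0 π (primeDivisorIdeal η))
    (hJ : IsEffectiveCartier (Scheme.IdealSheafData.ofIdealTop ((maximalIdeal S).map (Literature.AlgebraicGeometry.Morphisms.algebraMapΓ π))))
    (hneg : excCurveDegree π (CartierDivisor.ofIsEffectiveCartier _ hJ) η < 0) :
    Scheme.IdealSheafData.ofIdealTop ((maximalIdeal S).map (Literature.AlgebraicGeometry.Morphisms.algebraMapΓ π)) = primeDivisorIdeal η := by
  haveI : IsProper π := hπ.isProper
  obtain ⟨t, ht, hJt⟩ := exists_baseIdeal_maximalIdeal_eq_prod π hdim hrat hsing hπ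
  have hle : h0 π (Scheme.IdealSheafData.ofIdealTop ((maximalIdeal S).map (Literature.AlgebraicGeometry.Morphisms.algebraMapΓ π))) ≤ 1 :=
    QuadraticTransform.h0_baseIdeal_maximalIdeal_le_one π hdim hrat hπ
  revert hJ hle
  rw [hJt]
  intro hJ hneg hle
  rw [eq_singleton_of_firstKind_of_h0_le_one_of_excCurveDegree_neg hdim hrat hπ hη hfk t ht hJ hle hneg,
    Multiset.map_singleton, Multiset.prod_singleton]

/-- **The dichotomy for first-kind curves over a non-regular rational `S`**: for the cycle `Z` of `𝔪𝒪_X` and an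
integral exceptional curve `E_η` of the first kind, EITHER `(Z·E_η) = 0` (numerically, `E_η` is contracted by the
domination `X → Bl_𝔪 Spec S` of Lipman's (*), p. 203) OR `𝔪𝒪_X = 𝓘_η` (the closed fibre is the reduced curve `E_η`).
(`(Z·E_η) ≤ 0` always: tree `ExcCount.excCurveDegree_baseIdealDivisor_nonpos`.)
[cite: Lipman1969, Proposition (3.1) (p. 203); Proposition (13.1) (p. 223)] -/
theorem excCurveDegree_baseIdeal_eq_zero_or_eq_of_firstKind (hdim : ringKrullDim S = 2)
    (hrat : HasRationalSingularity S) (hsing : ¬ IsRegularLocalRing S) (hπ : IsResolution π)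
    {η : X} (hη : η ∈ excCurvePoints π)
    (hfk : h0 π (primeDivisorIdeal η ^ 2) = 3 * h0 π (primeDivisorIdeal η))
    (hJ : IsEffectiveCartier (Scheme.IdealSheafData.ofIdealTop ((maximalIdeal S).map (Literature.AlgebraicGeometry.Morphisms.algebraMapΓ π)))) :
    excCurveDegree π (CartierDivisor.ofIsEffectiveCartier _ hJ) η = 0 ∨
      Scheme.IdealSheafData.ofIdealTop ((maximalIdeal S).map (Literature.AlgebraicGeometry.Morphisms.algebraMapΓ π)) = primeDivisorIdeal η := by
  haveI : IsProper π := hπ.isProper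
  have hle0 := ExcCount.excCurveDegree_baseIdealDivisor_nonpos (π := π) hJ hη
  rcases hle0.lt_or_eq with hlt | heq
  · exact Or.inr (baseIdeal_eq_primeDivisorIdeal_of_firstKind_of_excCurveDegree_neg π hdim hrat hsing hπ hη hfk hJ hlt)
  · exact Or.inl heq

end BaseCycle

end Summit.ResolutionOfSingularities.ResolutionOfSingularities.Theorems.NoZeno.FirstKind

end
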